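import Summits.Ventures.PercRepro.RankLevelSetBiIndepPerElem

/-! # RankLevelSetBiIndepParallel — A PARALLEL PAIR REDUCES THE PER-ELEMENT PROFILE INEQUALITY (★★) TO A MINOR ON
TWO FEWER ELEMENTS: THE GENERAL CASE OF (★★) IS THE SIMPLE CASE (night-1 g25; dossier §37)

Let `{y, z}` be a PARALLEL PAIR of the finite matroid `M` (two distinct non-loops whose union is dependent) and
`N := M ／ {y} ＼ {z}` (contract `y`, delete `z`; a matroid on `#E − 2` elements). Every bi-independent set of `M`
contains EXACTLY ONE of `y`, `z` (`biIndep_mem_or`, `biIndep_not_both`), and the two halves are both copies of the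
bi-independent sets of `N` one level down (`ncard_biIndep_mem_left_eq`, `ncard_biIndep_mem_right_eq`: `S ↦ S ∖ {w}`,
using the swap `M.Indep (insert y X) ↔ M.Indep (insert z X)` of `parallel_insert_indep_iff`). Hence, for an element
`y' ∉ {y, z}`, both sides of (★★)_j(M; y') are TWICE the sides of (★★)_{j−1}(N; y'), and at `y` (or `z`) the
inequality reads `D_{j−1}(N) ≤ D_j(N)`, which is the monotone form of `N`. So:

* **`biIndepPerElem_of_parallel`**: `BiIndepPerElem (M ／ {y} ＼ {z}) → BiIndepPerElem M` — THE REDUCTION. Iterated,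
  (★★) for every finite matroid follows from (★★) for every SIMPLE one (a loop makes the bi-independent family empty,
  a parallel class of size ≥ 3 likewise, and a parallel pair is removed by this theorem).
* **`biIndepPerElem_parallel_iff`**: the reduction is an equivalence.
Every declaration has a docstring; imports: the cell's own modules and Mathlib only. Axioms: standard. -/

namespace PercRepro

open Set Matroid

variable {α : Type} (M : Matroid α)

/-- **A PARALLEL PAIR**: two distinct non-loops `y ≠ z` with `{y, z}` dependent. -/
def ParallelPair (y z : α) : Prop := y ≠ z ∧ M.IsNonloop y ∧ M.IsNonloop z ∧ ¬ M.Indep {y, z}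

/-- A parallel pair is symmetric. -/
lemma ParallelPair.symm {y z : α} (h : ParallelPair M y z) : ParallelPair M z y :=
  ⟨h.1.symm, h.2.2.1, h.2.1, by rw [Set.pair_comm]; exact h.2.2.2⟩

/-- In a parallel pair `z` lies in the closure of `{y}`. -/
lemma ParallelPair.mem_closure {y z : α} (h : ParallelPair M y z) : z ∈ M.closure {y} := by
  obtain ⟨hne, hy, hz, hdep⟩ := h
  have hy' : M.Indep {y} := indep_singleton.mpr hy
  have hzy : z ∉ ({y} : Set α) := by simpa using hne.symm
  by_contra hcl
  apply hdep
  rw [Set.pair_comm]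
  exact (hy'.insert_indep_iff_of_notMem hzy).mpr ⟨hz.mem_ground, hcl⟩

/-- **THE SWAP**: for `X` avoiding the parallel pair, `X ∪ {y}` is independent iff `X ∪ {z}` is. -/
lemma parallel_insert_indep_iff {y z : α} (h : ParallelPair M y z) {X : Set α} (hyX : y ∉ X) (hzX : z ∉ X) :
    M.Indep (insert y X) ↔ M.Indep (insert z X) := by
  have key : ∀ {a b : α}, ParallelPair M a b → a ∉ X → b ∉ X → M.Indep (insert a X) → M.Indep (insert b X) := by
    intro a b hab haX hbX hind
    have hX : M.Indep X := hind.subset (Set.subset_insert a X)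
    have ha : a ∈ M.E \ M.closure X := (hX.insert_indep_iff_of_notMem haX).mp hind
    refine (hX.insert_indep_iff_of_notMem hbX).mpr ⟨hab.2.2.1.mem_ground, fun hb => ha.2 ?_⟩
    have h1 : M.closure {b} ⊆ M.closure X := by
      have : ({b} : Set α) ⊆ M.closure X := Set.singleton_subset_iff.mpr hb
      exact (M.closure_subset_closure this).trans (by rw [M.closure_closure])
    exact h1 hab.symm.mem_closure
  exact ⟨key h hyX hzX, key h.symm hzX hyX⟩

/-- No bi-independent set contains both elements of a parallel pair. -/
lemma biIndep_not_both {y z : α} (h : ParallelPair M y z) {r : ℕ} {S : Set α} (hS : S ∈ biIndep M r) :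
    ¬ (y ∈ S ∧ z ∈ S) := by
  rintro ⟨hy, hz⟩
  exact h.2.2.2 (hS.2.2.1.subset (Set.pair_subset hy hz))

/-- Every bi-independent set contains one element of a parallel pair (its complement cannot contain both). -/
lemma biIndep_mem_or {y z : α} (h : ParallelPair M y z) {r : ℕ} {S : Set α} (hS : S ∈ biIndep M r) :
    y ∈ S ∨ z ∈ S := by
  by_contra hcon
  have hcon' := not_or.mp hcon
  exact h.2.2.2 (hS.2.2.2.subset (Set.pair_subset ⟨h.2.1.mem_ground, hcon'.1⟩ ⟨h.2.2.1.mem_ground, hcon'.2⟩))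

/-- The ground set of `N = M ／ {y} ＼ {z}` is `E ∖ {y, z}`. -/
lemma ground_contract_delete (y z : α) : (M ／ {y} ＼ {z}).E = M.E \ {y, z} := by
  rw [delete_ground, contract_ground, Set.sdiff_sdiff, Set.singleton_union]

/-- Independence in `N = M ／ {y} ＼ {z}`: `T` avoids `y` and `z`, and `T ∪ {y}` is independent in `M`. -/
lemma indep_contract_delete_iff {y z : α} (h : ParallelPair M y z) (T : Set α) :
    (M ／ {y} ＼ {z}).Indep T ↔ (y ∉ T ∧ z ∉ T) ∧ M.Indep (insert y T) := by
  rw [delete_indep_iff, h.2.1.contractElem_indep_iff, Set.disjoint_singleton_right]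
  tauto

/-- Independence in `N = M ／ {y} ＼ {z}` read through `z`: `T` avoids `z` and `y`, and `T ∪ {z}` is independent
in `M` (the swap). -/
lemma indep_contract_delete_iff' {y z : α} (h : ParallelPair M y z) (T : Set α) :
    (M ／ {y} ＼ {z}).Indep T ↔ (z ∉ T ∧ y ∉ T) ∧ M.Indep (insert z T) := by
  rw [indep_contract_delete_iff M h]
  constructor
  · rintro ⟨⟨h1, h2⟩, hind⟩; exact ⟨⟨h2, h1⟩, (parallel_insert_indep_iff M h h1 h2).mp hind⟩
  · rintro ⟨⟨h2, h1⟩, hind⟩; exact ⟨⟨h1, h2⟩, (parallel_insert_indep_iff M h h1 h2).mpr hind⟩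

/-- The complement in `E` of `insert w T` for `T ⊆ E ∖ {w, w'}` is `insert w' ((E ∖ {w, w'}) ∖ T)`. -/
lemma compl_insert_eq {w w' : α} (hne : w ≠ w') (hw'E : w' ∈ M.E) {T : Set α}
    (hT : T ⊆ M.E \ {w, w'}) :
    M.E \ insert w T = insert w' ((M.E \ {w, w'}) \ T) := by
  have hw'T : w' ∉ T := fun hx => (hT hx).2 (Set.mem_insert_of_mem w rfl)
  ext x
  simp only [Set.mem_sdiff, Set.mem_insert_iff, Set.mem_singleton_iff, not_or]
  constructor
  · rintro ⟨hxE, hxw, hxT⟩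
    by_cases hxw' : x = w'
    · exact Or.inl hxw'
    · exact Or.inr ⟨⟨hxE, hxw, hxw'⟩, hxT⟩
  · rintro (rfl | ⟨⟨hxE, hxw, -⟩, hxT⟩)
    · exact ⟨hw'E, hne.symm, hw'T⟩
    · exact ⟨hxE, hxw, hxT⟩

variable [M.Finite]

/-- **The split of a level by the parallel pair**:
`#{S ∈ D_r : P S} = #{S ∈ D_r : y ∈ S ∧ P S} + #{S ∈ D_r : z ∈ S ∧ P S}`. -/
lemma ncard_biIndep_split {y z : α} (h : ParallelPair M y z) (r : ℕ) (P : Set α → Prop) :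
    {S ∈ biIndep M r | P S}.ncard =
      {S ∈ biIndep M r | y ∈ S ∧ P S}.ncard + {S ∈ biIndep M r | z ∈ S ∧ P S}.ncard := by
  have hfin : {S ∈ biIndep M r | P S}.Finite := (biIndep_finite M r).subset (fun S hS => hS.1)
  have hdisj : Disjoint {S ∈ biIndep M r | y ∈ S ∧ P S} {S ∈ biIndep M r | z ∈ S ∧ P S} := by
    rw [Set.disjoint_left]
    rintro S ⟨hS, hy, -⟩ ⟨-, hz, -⟩
    exact biIndep_not_both M h hS ⟨hy, hz⟩
  have hunion : {S ∈ biIndep M r | P S} =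
      {S ∈ biIndep M r | y ∈ S ∧ P S} ∪ {S ∈ biIndep M r | z ∈ S ∧ P S} := by
    ext S
    simp only [Set.mem_setOf_eq, Set.mem_union]
    constructor
    · rintro ⟨hS, hP⟩
      rcases biIndep_mem_or M h hS with hy | hz
      · exact Or.inl ⟨hS, hy, hP⟩
      · exact Or.inr ⟨hS, hz, hP⟩
    · rintro (⟨hS, -, hP⟩ | ⟨hS, -, hP⟩) <;> exact ⟨hS, hP⟩
  rw [hunion, Set.ncard_union_eq hdisj (hfin.subset (by rw [hunion]; exact Set.subset_union_left))
    (hfin.subset (by rw [hunion]; exact Set.subset_union_right))]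

/-- **THE CORE BIJECTION** (abstract form): if `N` is a matroid on `E ∖ {w, w'}` whose independent sets are the
`T` with `T ∪ {w}` independent in `M`, no bi-independent set of `M` meets both `w` and `w'`, and `X ∪ {w}`,
`X ∪ {w'}` are independent together, then `S ↦ S ∖ {w}` is a bijection from `{S ∈ D_{r+1}(M) : w ∈ S ∧ P S}` onto
`{T ∈ D_r(N) : P (insert w T)}`. -/
lemma ncard_biIndep_mem_eq_core (N : Matroid α) {w w' : α} (hne : w ≠ w') (hwE : w ∈ M.E)
    (hw'E : w' ∈ M.E) (hground : N.E = M.E \ {w, w'})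
    (hNind : ∀ T : Set α, N.Indep T ↔ (w ∉ T ∧ w' ∉ T) ∧ M.Indep (insert w T))
    (hboth : ∀ {r : ℕ} {S : Set α}, S ∈ biIndep M r → ¬ (w ∈ S ∧ w' ∈ S))
    (hswap : ∀ X : Set α, w ∉ X → w' ∉ X → (M.Indep (insert w X) ↔ M.Indep (insert w' X)))
    (r : ℕ) (P : Set α → Prop) :
    {S ∈ biIndep M (r + 1) | w ∈ S ∧ P S}.ncard = {T ∈ biIndep N r | P (insert w T)}.ncard := by
  classical
  have hEfin : M.E.Finite := M.ground_finite
  have hnot : ∀ T : Set α, T ⊆ M.E \ {w, w'} → w ∉ T ∧ w' ∉ T := by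
    intro T hT
    exact ⟨fun hx => (hT hx).2 (Set.mem_insert w _), fun hx => (hT hx).2 (Set.mem_insert_of_mem w rfl)⟩
  have hnot' : ∀ T : Set α, w ∉ (M.E \ {w, w'}) \ T ∧ w' ∉ (M.E \ {w, w'}) \ T := by
    intro T
    exact ⟨fun hx => hx.1.2 (Set.mem_insert w _), fun hx => hx.1.2 (Set.mem_insert_of_mem w rfl)⟩
  refine Set.ncard_congr (fun S _ => S \ {w}) ?_ ?_ ?_
  · -- maps into the target
    rintro S ⟨⟨hSE, hScard, hSind, hScind⟩, hwS, hP⟩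
    have hw'S : w' ∉ S := fun hw'S => hboth ⟨hSE, hScard, hSind, hScind⟩ ⟨hwS, hw'S⟩
    have hTsub : S \ {w} ⊆ M.E \ {w, w'} := by
      intro x hx
      refine ⟨hSE hx.1, ?_⟩
      simp only [Set.mem_insert_iff, Set.mem_singleton_iff, not_or]
      exact ⟨hx.2, fun hxw' => hw'S (hxw' ▸ hx.1)⟩
    have hins : insert w (S \ {w}) = S := by
      rw [Set.insert_sdiff_singleton, Set.insert_eq_of_mem hwS]
    refine ⟨⟨by rw [hground]; exact hTsub, ?_, ?_, ?_⟩, ?_⟩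
    · rw [Set.ncard_sdiff_singleton_of_mem hwS, hScard]; rfl
    · rw [hNind]
      exact ⟨hnot _ hTsub, by rw [hins]; exact hSind⟩
    · rw [hNind, hground]
      refine ⟨hnot' _, ?_⟩
      rw [hswap _ (hnot' _).1 (hnot' _).2, ← compl_insert_eq M hne hw'E hTsub, hins]
      exact hScind
    · rw [hins]; exact hP
  · -- injective
    rintro S S' ⟨-, hwS, -⟩ ⟨-, hwS', -⟩ hSS'
    have h1 : insert w (S \ {w}) = insert w (S' \ {w}) := by rw [hSS']
    rwa [Set.insert_sdiff_singleton, Set.insert_sdiff_singleton, Set.insert_eq_of_mem hwS,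
      Set.insert_eq_of_mem hwS'] at h1
  · -- surjective
    rintro T ⟨⟨hTE, hTcard, hTind, hTcind⟩, hP⟩
    rw [hground] at hTE hTcind
    have hwT : w ∉ T := (hnot T hTE).1
    have hTfin : T.Finite := hEfin.subset (fun x hx => (hTE hx).1)
    refine ⟨insert w T, ⟨⟨Set.insert_subset hwE (fun x hx => (hTE hx).1), ?_, ?_, ?_⟩,
      Set.mem_insert w T, hP⟩, ?_⟩
    · rw [Set.ncard_insert_of_notMem hwT hTfin, hTcard]
    · exact ((hNind T).mp hTind).2
    · rw [compl_insert_eq M hne hw'E hTE, ← hswap _ (hnot' T).1 (hnot' T).2]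
      exact ((hNind _).mp hTcind).2
    · rw [Set.insert_sdiff_of_mem _ (Set.mem_singleton w), Set.sdiff_singleton_eq_self hwT]

/-- **The bi-independent sets of `M` through `y` are the bi-independent sets of `N = M ／ {y} ＼ {z}` one level
down**: `#{S ∈ D_{r+1}(M) : y ∈ S ∧ P S} = #{T ∈ D_r(N) : P (insert y T)}`. -/
lemma ncard_biIndep_mem_left_eq {y z : α} (h : ParallelPair M y z) (r : ℕ) (P : Set α → Prop) :
    {S ∈ biIndep M (r + 1) | y ∈ S ∧ P S}.ncard =
      {T ∈ biIndep (M ／ {y} ＼ {z}) r | P (insert y T)}.ncard :=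
  ncard_biIndep_mem_eq_core M (M ／ {y} ＼ {z}) h.1 h.2.1.mem_ground h.2.2.1.mem_ground
    (ground_contract_delete M y z) (indep_contract_delete_iff M h)
    (fun hS => biIndep_not_both M h hS) (fun _ h1 h2 => parallel_insert_indep_iff M h h1 h2) r P

/-- **The bi-independent sets of `M` through `z` are the bi-independent sets of `N = M ／ {y} ＼ {z}` one level
down**: `#{S ∈ D_{r+1}(M) : z ∈ S ∧ P S} = #{T ∈ D_r(N) : P (insert z T)}`. -/
lemma ncard_biIndep_mem_right_eq {y z : α} (h : ParallelPair M y z) (r : ℕ) (P : Set α → Prop) :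
    {S ∈ biIndep M (r + 1) | z ∈ S ∧ P S}.ncard =
      {T ∈ biIndep (M ／ {y} ＼ {z}) r | P (insert z T)}.ncard :=
  ncard_biIndep_mem_eq_core M (M ／ {y} ＼ {z}) h.1.symm h.2.2.1.mem_ground h.2.1.mem_ground
    (by rw [ground_contract_delete, Set.pair_comm]) (indep_contract_delete_iff' M h)
    (fun hS hyz => biIndep_not_both M h hS ⟨hyz.2, hyz.1⟩)
    (fun _ h1 h2 => (parallel_insert_indep_iff M h h2 h1).symm) r P

/-- `D_i ≤ D_{i+1}` below the middle, from the monotone form `(#E − i)·D_i ≤ (i + 1)·D_{i+1}`. -/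
lemma biIndepCount_le_succ_of_biIndepMono (N : Matroid α) [N.Finite] (hN : BiIndepMono N) {i : ℕ}
    (hi : 2 * i + 1 < N.E.ncard) : biIndepCount N i ≤ biIndepCount N (i + 1) := by
  have h := hN i hi
  have h2 : (i + 1) * biIndepCount N i ≤ (N.E.ncard - i) * biIndepCount N i :=
    Nat.mul_le_mul_right _ (by omega)
  exact Nat.le_of_mul_le_mul_left (h2.trans h) (by omega)

/-- For `y' ≠ w`, the filters `y' ∉ insert w T` and `y' ∉ T` agree. -/
lemma filter_notMem_insert_eq (𝒮 : Set (Set α)) {y' w : α} (hne : y' ≠ w) :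
    {T ∈ 𝒮 | y' ∉ insert w T} = {T ∈ 𝒮 | y' ∉ T} := by
  ext T; simp only [Set.mem_setOf_eq, Set.mem_insert_iff, hne, false_or]

/-- For `y' ≠ w`, the filters `y' ∈ insert w T` and `y' ∈ T` agree. -/
lemma filter_mem_insert_eq (𝒮 : Set (Set α)) {y' w : α} (hne : y' ≠ w) :
    {T ∈ 𝒮 | y' ∈ insert w T} = {T ∈ 𝒮 | y' ∈ T} := by
  ext T; simp only [Set.mem_setOf_eq, Set.mem_insert_iff, hne, false_or]

/-- The ground set of `N = M ／ {y} ＼ {z}` has `#E − 2` elements. -/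
lemma ncard_ground_contract_delete {y z : α} (h : ParallelPair M y z) :
    (M ／ {y} ＼ {z}).E.ncard = M.E.ncard - 2 := by
  rw [ground_contract_delete, Set.ncard_sdiff' (Set.pair_subset h.2.1.mem_ground h.2.2.1.mem_ground)
    M.ground_finite, Set.ncard_pair h.1]

/-- With a parallel pair the ground set is dependent, so there is no bi-independent `0`-set. -/
lemma biIndep_zero_eq_empty {y z : α} (h : ParallelPair M y z) : biIndep M 0 = ∅ := by
  ext S
  simp only [Set.mem_empty_iff_false, iff_false]
  intro hS
  have hS0 : S = ∅ := Set.ncard_eq_zero (M.ground_finite.subset hS.1) |>.mp hS.2.1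
  rw [hS0] at hS
  have hE : M.Indep M.E := by simpa using hS.2.2.2
  exact h.2.2.2 (hE.subset (Set.pair_subset h.2.1.mem_ground h.2.2.1.mem_ground))

/-- For `y' ∉ {y, z}`: `#{Z ∈ D_{j+1}(M) : y' ∉ Z} = 2·#{T ∈ D_j(N) : y' ∉ T}`. -/
lemma ncard_notMem_eq_two_mul {y z y' : α} (h : ParallelPair M y z) (hyy : y' ≠ y) (hyz : y' ≠ z) (j : ℕ) :
    {Z ∈ biIndep M (j + 1) | y' ∉ Z}.ncard = 2 * {T ∈ biIndep (M ／ {y} ＼ {z}) j | y' ∉ T}.ncard := by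
  rw [ncard_biIndep_split M h (j + 1) (fun Z => y' ∉ Z),
    ncard_biIndep_mem_left_eq M h j (fun Z => y' ∉ Z),
    ncard_biIndep_mem_right_eq M h j (fun Z => y' ∉ Z),
    filter_notMem_insert_eq _ hyy, filter_notMem_insert_eq _ hyz]
  ring

/-- For `y' ∉ {y, z}`: `#{Q ∈ D_{j+1}(M) : y' ∈ Q} = 2·#{T ∈ D_j(N) : y' ∈ T}`. -/
lemma ncard_mem_eq_two_mul {y z y' : α} (h : ParallelPair M y z) (hyy : y' ≠ y) (hyz : y' ≠ z) (j : ℕ) :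
    {Q ∈ biIndep M (j + 1) | y' ∈ Q}.ncard = 2 * {T ∈ biIndep (M ／ {y} ＼ {z}) j | y' ∈ T}.ncard := by
  rw [ncard_biIndep_split M h (j + 1) (fun Q => y' ∈ Q),
    ncard_biIndep_mem_left_eq M h j (fun Q => y' ∈ Q),
    ncard_biIndep_mem_right_eq M h j (fun Q => y' ∈ Q),
    filter_mem_insert_eq _ hyy, filter_mem_insert_eq _ hyz]
  ring

/-- **THE REDUCTION**: if `N = M ／ {y} ＼ {z}` satisfies (★★) for a parallel pair `{y, z}`, so does `M`. -/
theorem biIndepPerElem_of_parallel {y z : α} (h : ParallelPair M y z)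
    (hN : BiIndepPerElem (M ／ {y} ＼ {z})) : BiIndepPerElem M := by
  intro y' hy' j hj
  have hNE : (M ／ {y} ＼ {z}).E.ncard = M.E.ncard - 2 := ncard_ground_contract_delete M h
  have hMono : BiIndepMono (M ／ {y} ＼ {z}) := biIndepMono_of_perElem _ hN
  have hnotT : ∀ {r : ℕ} {T : Set α}, T ∈ biIndep (M ／ {y} ＼ {z}) r → y ∉ T ∧ z ∉ T := by
    intro r T hT
    have hTE := hT.1
    rw [ground_contract_delete] at hTE
    exact ⟨fun hx => (hTE hx).2 (Set.mem_insert y _), fun hx => (hTE hx).2 (Set.mem_insert_of_mem y rfl)⟩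
  cases j with
  | zero =>
    have : {Z ∈ biIndep M 0 | y' ∉ Z} = ∅ := by
      rw [biIndep_zero_eq_empty M h]; ext Z; simp
    rw [this, Set.ncard_empty]
    exact Nat.zero_le _
  | succ j' =>
    have hj' : 2 * j' + 1 < (M ／ {y} ＼ {z}).E.ncard := by omega
    by_cases hyy : y' = y
    · -- the element `y` itself: `D_{j'}(N) ≤ D_{j'+1}(N)`
      subst hyy
      have hL : {Z ∈ biIndep M (j' + 1) | y' ∉ Z}.ncard = biIndepCount (M ／ {y'} ＼ {z}) j' := by
        have e1 : {Z ∈ biIndep M (j' + 1) | y' ∉ Z} = {Z ∈ biIndep M (j' + 1) | z ∈ Z ∧ y' ∉ Z} := by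
          ext Z
          simp only [Set.mem_setOf_eq]
          constructor
          · rintro ⟨hZ, hyZ⟩
            exact ⟨hZ, (biIndep_mem_or M h hZ).resolve_left hyZ, hyZ⟩
          · rintro ⟨hZ, -, hyZ⟩; exact ⟨hZ, hyZ⟩
        rw [e1, ncard_biIndep_mem_right_eq M h j' (fun Z => y' ∉ Z)]
        unfold biIndepCount
        congr 1
        ext T
        simp only [Set.mem_setOf_eq, Set.mem_insert_iff, not_or, and_iff_left_iff_imp]
        intro hT
        exact ⟨h.1, (hnotT hT).1⟩
      have hR : {Q ∈ biIndep M (j' + 1 + 1) | y' ∈ Q}.ncard = biIndepCount (M ／ {y'} ＼ {z}) (j' + 1) := by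
        have e1 : {Q ∈ biIndep M (j' + 1 + 1) | y' ∈ Q} = {Q ∈ biIndep M (j' + 1 + 1) | y' ∈ Q ∧ y' ∈ Q} := by
          ext Q; simp only [Set.mem_setOf_eq, and_self]
        rw [e1, ncard_biIndep_mem_left_eq M h (j' + 1) (fun Q => y' ∈ Q)]
        unfold biIndepCount
        congr 1
        ext T
        simp only [Set.mem_setOf_eq, Set.mem_insert_iff, true_or, and_true]
      rw [hL, hR]
      exact biIndepCount_le_succ_of_biIndepMono _ hMono hj'
    · by_cases hyz : y' = z
      · -- the element `z`: symmetric
        subst hyz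
        have hL : {Z ∈ biIndep M (j' + 1) | y' ∉ Z}.ncard = biIndepCount (M ／ {y} ＼ {y'}) j' := by
          have e1 : {Z ∈ biIndep M (j' + 1) | y' ∉ Z} = {Z ∈ biIndep M (j' + 1) | y ∈ Z ∧ y' ∉ Z} := by
            ext Z
            simp only [Set.mem_setOf_eq]
            constructor
            · rintro ⟨hZ, hzZ⟩
              exact ⟨hZ, (biIndep_mem_or M h hZ).resolve_right hzZ, hzZ⟩
            · rintro ⟨hZ, -, hzZ⟩; exact ⟨hZ, hzZ⟩
          rw [e1, ncard_biIndep_mem_left_eq M h j' (fun Z => y' ∉ Z)]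
          unfold biIndepCount
          congr 1
          ext T
          simp only [Set.mem_setOf_eq, Set.mem_insert_iff, not_or, and_iff_left_iff_imp]
          intro hT
          exact ⟨h.1.symm, (hnotT hT).2⟩
        have hR : {Q ∈ biIndep M (j' + 1 + 1) | y' ∈ Q}.ncard = biIndepCount (M ／ {y} ＼ {y'}) (j' + 1) := by
          have e1 : {Q ∈ biIndep M (j' + 1 + 1) | y' ∈ Q} =
              {Q ∈ biIndep M (j' + 1 + 1) | y' ∈ Q ∧ y' ∈ Q} := by
            ext Q; simp only [Set.mem_setOf_eq, and_self]
          rw [e1, ncard_biIndep_mem_right_eq M h (j' + 1) (fun Q => y' ∈ Q)]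
          unfold biIndepCount
          congr 1
          ext T
          simp only [Set.mem_setOf_eq, Set.mem_insert_iff, true_or, and_true]
        rw [hL, hR]
        exact biIndepCount_le_succ_of_biIndepMono _ hMono hj'
      · -- an element outside the pair: both sides are twice the sides of (★★)_{j'}(N; y')
        have hy'N : y' ∈ (M ／ {y} ＼ {z}).E := by
          rw [ground_contract_delete]
          exact ⟨hy', by simp only [Set.mem_insert_iff, Set.mem_singleton_iff, not_or]; exact ⟨hyy, hyz⟩⟩
        rw [ncard_notMem_eq_two_mul M h hyy hyz, ncard_mem_eq_two_mul M h hyy hyz]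
        exact Nat.mul_le_mul_left 2 (hN y' hy'N j' hj')

/-- **THE REDUCTION IS AN EQUIVALENCE**: for a parallel pair `{y, z}`, `M` satisfies (★★) iff `M ／ {y} ＼ {z}` does
(the membership of `M` in the (★★)-class is decided by a minor on two fewer elements). -/
theorem biIndepPerElem_parallel_iff {y z : α} (h : ParallelPair M y z) :
    BiIndepPerElem M ↔ BiIndepPerElem (M ／ {y} ＼ {z}) := by
  refine ⟨fun hM => ?_, biIndepPerElem_of_parallel M h⟩
  intro y' hy' j hj
  have hNE : (M ／ {y} ＼ {z}).E.ncard = M.E.ncard - 2 := ncard_ground_contract_delete M h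
  have hy'E : y' ∈ M.E := by
    rw [ground_contract_delete] at hy'; exact hy'.1
  have hyy : y' ≠ y := by
    rw [ground_contract_delete] at hy'
    rintro rfl; exact hy'.2 (Set.mem_insert y' _)
  have hyz : y' ≠ z := by
    rw [ground_contract_delete] at hy'
    rintro rfl; exact hy'.2 (Set.mem_insert_of_mem y rfl)
  have hM' := hM y' hy'E (j + 1) (by omega)
  rw [ncard_notMem_eq_two_mul M h hyy hyz, ncard_mem_eq_two_mul M h hyy hyz] at hM'
  exact Nat.le_of_mul_le_mul_left hM' (by norm_num)

end PercRepro
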